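import Literature.Computability.Complexity.HardcoreInapproximabilityCycleMoments
import Literature.Computability.Complexity.HardcoreInapproximabilitySSCLowerTail
import Literature.Computability.Complexity.HardcoreInapproximabilitySecondMomentTau
import Literature.Computability.Complexity.HardcoreInapproximabilitySecondMomentFormula
import HarnessLib

/-!
# Sly (2010), Lemma 3.9 — the pointwise lower tail of one slice `Z_{a,b}(η)` of the core

The small-subgraph-conditioning step of [Sly2010, §3.2] for the configuration-type bipartite core:
given the three model inputs — (P) the planted lower bound on the cycle-count binomial moments
(Lemma 3.8, `sly_planted_lower`), (S) the second-moment ratio bound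
`|Ω| Σ Z² ≤ (1+ε) τ (Σ Z)²` on the window (Lemma 3.5 with Theorem 3.10's window) and the
positivity of `Σ_ω Z_{a,b}` — as hypotheses, and the cycle-count moments (U)/(L) of Lemma 3.7
(`sly_cycleBinom_bounds`), the abstract bound `ssc_lowerTail_le'` yields
`sly_perSlice_of_inputs`: for every `θ > 0` there are `χ > 0`, `n₀` with
`#{ω : Z_{a,b}(η)(ω) ≤ (2/√n) E Z_{a,b}(η)} ≤ θ |Ω|` for all `n ≥ n₀`, `m' ≤ n^{1/10}`, all
boundaries `η` and all slices in the `χ`-window around `(p⁺ n, p⁻ n)`.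

The parameter choice follows Janson's argument: with `V = Σ_i λ_i δ_i² = log τ`
(`slyTau_eq_exp`, `sum_cycleWeights_sq_le`, `tendsto_exp_sum_cycleWeights_sq`), first `M` (Chebyshev
level for `log W`), then `v = e^{-M-V}/4`, then the number `k` of cycle lengths (`τ_k → τ`), then the
moment accuracy `ε₁`, then the truncation `B` (`eventually_sscP_ge`, `tendsto_sum_pow_div_factorial`),
and finally `n` (`t = 2/√n ≤ v`).  Also recorded: the Poisson-world constants `sscPinf`, `sscAinf`
with `P_∞²/A_∞ = τ_k` (`sscPinf_sq_div`) and `P_∞/A_∞ = e^{-Σλ_iδ_i}` (`sscPinf_div`).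

## References
* [Sly2010] A. Sly, *Computational transition at the uniqueness threshold*, FOCS 2010,
  arXiv:1005.5584, Lemma 3.9, Theorem 3.6 and the proof of Theorem 3.10.
* [MosselWeitzWormald2008] E. Mossel, D. Weitz, N. Wormald, *On the hardness of sampling
  independent sets beyond the tree threshold*, PTRF 143 (2009), Theorem 7.1, Lemma 7.6.
-/

namespace Literature.Computability.Complexity

open Finset Real Filter Topology Nat

section PoissonLimits

variable {k : ℕ}

/-- The limit planted first moment `P_∞ = Π_i exp(λ_i (1+δ_i) δ_i)`. [folklore] -/
noncomputable def sscPinf (lam δ : Fin k → ℝ) : ℝ := ∏ i : Fin k, Real.exp (lam i * (1 + δ i) * δ i)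

/-- The limit second moment `A_∞ = Π_i exp(λ_i (2δ_i + δ_i²))`. [folklore] -/
noncomputable def sscAinf (lam δ : Fin k → ℝ) : ℝ := ∏ i : Fin k, Real.exp (lam i * (2 * δ i + δ i ^ 2))

/-- `P_∞ = exp(Σ λ_i δ_i + Σ λ_i δ_i²)`. [folklore] -/
theorem sscPinf_eq_exp (lam δ : Fin k → ℝ) :
    sscPinf lam δ = Real.exp (∑ i, lam i * δ i + ∑ i, lam i * δ i ^ 2) := by
  unfold sscPinf
  rw [← Finset.sum_add_distrib, Real.exp_sum]
  refine Finset.prod_congr rfl fun i _ => ?_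
  congr 1; ring

/-- `A_∞ = exp(2 Σ λ_i δ_i + Σ λ_i δ_i²)`. [folklore] -/
theorem sscAinf_eq_exp (lam δ : Fin k → ℝ) :
    sscAinf lam δ = Real.exp (2 * ∑ i, lam i * δ i + ∑ i, lam i * δ i ^ 2) := by
  unfold sscAinf
  rw [Finset.mul_sum, ← Finset.sum_add_distrib, Real.exp_sum]
  refine Finset.prod_congr rfl fun i _ => ?_
  congr 1; ring

/-- **The explained variance**: `P_∞²/A_∞ = exp(Σ λ_i δ_i²) = τ_k`. [cite: MosselWeitzWormald2008, Theorem 7.1 (proof)] -/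
theorem sscPinf_sq_div (lam δ : Fin k → ℝ) :
    sscPinf lam δ ^ 2 / sscAinf lam δ = Real.exp (∑ i, lam i * δ i ^ 2) := by
  rw [sscPinf_eq_exp, sscAinf_eq_exp, sq, ← Real.exp_add, ← Real.exp_sub]
  congr 1; ring

/-- `P_∞/A_∞ = exp(-Σ λ_i δ_i)`. [folklore] -/
theorem sscPinf_div (lam δ : Fin k → ℝ) :
    sscPinf lam δ / sscAinf lam δ = Real.exp (-∑ i, lam i * δ i) := by
  rw [sscPinf_eq_exp, sscAinf_eq_exp, ← Real.exp_sub]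
  congr 1; ring

/-- `P_∞ > 0`. [folklore] -/
theorem sscPinf_pos (lam δ : Fin k → ℝ) : 0 < sscPinf lam δ := by
  unfold sscPinf; exact Finset.prod_pos fun i _ => Real.exp_pos _

/-- `A_∞ > 0`. [folklore] -/
theorem sscAinf_pos (lam δ : Fin k → ℝ) : 0 < sscAinf lam δ := by
  unfold sscAinf; exact Finset.prod_pos fun i _ => Real.exp_pos _

/-- **`P_B ≥ (1-η) P_∞` eventually in `B`.** [folklore] -/
theorem eventually_sscP_ge (lam δ : Fin k → ℝ) {η : ℝ} (hη : 0 < η) :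
    ∀ᶠ B : ℕ in atTop, (1 - η) * sscPinf lam δ ≤ sscP lam δ B := by
  have h := tendsto_sscP lam δ
  have hP := sscPinf_pos lam δ
  have : (1 - η) * sscPinf lam δ < sscPinf lam δ := by nlinarith
  exact h.eventually_const_le this

/-- **The truncation term vanishes**: `Σ_i λ_i^{B+1}/(B+1)! → 0`. [folklore] -/
theorem tendsto_sum_pow_div_factorial (lam : Fin k → ℝ) :
    Tendsto (fun B : ℕ => ∑ i : Fin k, lam i ^ (B + 1) / ((B + 1).factorial : ℝ)) atTop (𝓝 0) := by
  have : Tendsto (fun B : ℕ => ∑ i : Fin k, lam i ^ (B + 1) / ((B + 1).factorial : ℝ)) atTop (𝓝 (∑ _i : Fin k, (0 : ℝ))) := by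
    refine tendsto_finsetSum _ fun i _ => ?_
    exact (FloorSemiring.tendsto_pow_div_factorial_atTop (lam i)).comp (tendsto_add_atTop_nat 1)
  simpa using this

/-- `log(1+δ) ≤ δ` and `δ - log(1+δ) ≤ δ²` for `δ ≥ 0`. [folklore] -/
theorem log_one_add_bounds {δ : ℝ} (hδ : 0 ≤ δ) : Real.log (1 + δ) ≤ δ ∧ δ - δ ^ 2 ≤ Real.log (1 + δ) := by
  have h1 : 0 < 1 + δ := by linarith
  constructor
  · have := Real.log_le_sub_one_of_pos h1; linarith
  · have h2 := Real.one_sub_inv_le_log_of_pos h1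
    have h3 : δ - δ ^ 2 ≤ 1 - (1 + δ)⁻¹ := by
      rw [show 1 - (1 + δ)⁻¹ = δ / (1 + δ) by field_simp; ring, le_div_iff₀ h1]
      nlinarith [sq_nonneg δ]
    linarith

/-- `A_B ≥ 1` (its `c = c' = 0` term). [folklore] -/
theorem one_le_sscA {lam δ : Fin k → ℝ} (hlam : ∀ i, 0 ≤ lam i) (hδ : ∀ i, 0 ≤ δ i) (B : ℕ) : 1 ≤ sscA lam δ B := by
  unfold sscA
  set F : (Fin k → ℕ) → (Fin k → ℕ) → ℝ := fun c c' => (∏ i, δ i ^ c i) * (∏ i, δ i ^ c' i) *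
    ∏ i, ∑ r ∈ range (c' i + 1), ((c i).choose r : ℝ) * (((c i) + (c' i - r)).choose (c i) : ℝ) *
      (lam i ^ (c i + (c' i - r)) / ((c i + (c' i - r)).factorial : ℝ)) with hF
  show 1 ≤ ∑ c ∈ sscBox k B, ∑ c' ∈ sscBox k B, F c c'
  have h0 := zero_mem_sscBox k B
  have hterm : ∀ c c', 0 ≤ F c c' := by
    intro c c'
    simp only [hF]
    refine mul_nonneg (mul_nonneg (Finset.prod_nonneg fun i _ => pow_nonneg (hδ i) _) (Finset.prod_nonneg fun i _ => pow_nonneg (hδ i) _))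
      (Finset.prod_nonneg fun i _ => Finset.sum_nonneg fun r _ => ?_)
    have := hlam i; positivity
  have hdiag : F (fun _ => 0) (fun _ => 0) = 1 := by
    simp [hF]
  calc (1 : ℝ) = F (fun _ => 0) (fun _ => 0) := hdiag.symm
    _ ≤ ∑ c' ∈ sscBox k B, F (fun _ => 0) c' :=
        Finset.single_le_sum (f := fun c' => F (fun _ => 0) c') (fun c' _ => hterm _ c') h0
    _ ≤ ∑ c ∈ sscBox k B, ∑ c' ∈ sscBox k B, F c c' :=
        Finset.single_le_sum (f := fun c => ∑ c' ∈ sscBox k B, F c c') (fun c _ => Finset.sum_nonneg fun c' _ => hterm c c') h0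

/-- `A_B > 0`. [folklore] -/
theorem sscA_pos {lam δ : Fin k → ℝ} (hlam : ∀ i, 0 ≤ lam i) (hδ : ∀ i, 0 ≤ δ i) (B : ℕ) : 0 < sscA lam δ B :=
  lt_of_lt_of_le one_pos (one_le_sscA hlam hδ B)

end PoissonLimits

section CycleSeries

/-- **Sly's/MWW's constant is the exponential of the cycle series**:
`slyTau (q+1) p⁺ p⁻ = exp(-(1/2) log(1 - (q r)²) + q (-(1/2) log(1 - r²)))`, `r = p⁺p⁻/((1-p⁺)(1-p⁻))`
(`q r < 1`, `r < 1`). [cite: MosselWeitzWormald2008, Lemma 7.6; Sly2010, Lemma 3.9] -/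
theorem slyTau_eq_exp (q : ℕ) {pp pm : ℝ} (hr0 : 0 ≤ pp * pm / ((1 - pp) * (1 - pm)))
    (hqr : (q : ℝ) * (pp * pm / ((1 - pp) * (1 - pm))) < 1) (hr1 : pp * pm / ((1 - pp) * (1 - pm)) < 1) :
    slyTau (q + 1) pp pm =
      Real.exp (-(1 / 2) * Real.log (1 - ((q : ℝ) * (pp * pm / ((1 - pp) * (1 - pm)))) ^ 2) +
        (q : ℝ) * (-(1 / 2) * Real.log (1 - (pp * pm / ((1 - pp) * (1 - pm))) ^ 2))) := by
  unfold slyTau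
  set r := pp * pm / ((1 - pp) * (1 - pm)) with hr
  have hq : (((q + 1 : ℕ) : ℝ) - 1) = q := by push_cast; ring
  rw [hq]
  have h1 : 0 < 1 - ((q : ℝ) * r) ^ 2 := by
    have : 0 ≤ (q : ℝ) * r := by positivity
    nlinarith
  have h2 : 0 < 1 - r ^ 2 := by nlinarith
  rw [show (q : ℝ) ^ 2 * r ^ 2 = ((q : ℝ) * r) ^ 2 by ring, Real.rpow_def_of_pos h1, Real.rpow_def_of_pos h2, ← Real.exp_add]
  congr 1; ring

/-- The partial cycle sums over `Fin k` are the `range k` partial sums. [folklore] -/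
theorem sum_fin_cycleWeights_sq (q k : ℕ) (r : ℝ) :
    ∑ i : Fin k, ((q : ℝ) ^ (2 * ((i : ℕ) + 1)) + q) / (2 * ((i : ℝ) + 1)) * (r ^ ((i : ℕ) + 1)) ^ 2 =
      ∑ i ∈ range k, ((q : ℝ) ^ (2 * (i + 1)) + q) / (2 * ((i : ℝ) + 1)) * (r ^ (i + 1)) ^ 2 :=
  Fin.sum_univ_eq_sum_range (fun i => ((q : ℝ) ^ (2 * (i + 1)) + q) / (2 * ((i : ℝ) + 1)) * (r ^ (i + 1)) ^ 2) k

/-- **Partial explained variance is below `log τ`**: `Σ_{i<k} λ_i δ_i² ≤ log τ`. [folklore] -/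
theorem sum_cycleWeights_sq_le (q k : ℕ) {r : ℝ} (hr0 : 0 ≤ r) (hqr : (q : ℝ) * r < 1) (hr1 : r < 1) :
    ∑ i ∈ range k, ((q : ℝ) ^ (2 * (i + 1)) + q) / (2 * ((i : ℝ) + 1)) * (r ^ (i + 1)) ^ 2 ≤
      -(1 / 2) * Real.log (1 - ((q : ℝ) * r) ^ 2) + (q : ℝ) * (-(1 / 2) * Real.log (1 - r ^ 2)) :=
  sum_le_hasSum (range k) (fun i _ => by positivity) (hasSum_cycleWeights_sq hr0 hqr hr1)

/-- **The explained variance converges**: `exp(Σ_{i<k} λ_i δ_i²) → τ` as `k → ∞`. [folklore] -/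
theorem tendsto_exp_sum_cycleWeights_sq (q : ℕ) {r : ℝ} (hr0 : 0 ≤ r) (hqr : (q : ℝ) * r < 1) (hr1 : r < 1) :
    Tendsto (fun k : ℕ => Real.exp (∑ i ∈ range k, ((q : ℝ) ^ (2 * (i + 1)) + q) / (2 * ((i : ℝ) + 1)) * (r ^ (i + 1)) ^ 2))
      atTop (𝓝 (Real.exp (-(1 / 2) * Real.log (1 - ((q : ℝ) * r) ^ 2) + (q : ℝ) * (-(1 / 2) * Real.log (1 - r ^ 2))))) :=
  (Real.continuous_exp.tendsto _).comp (hasSum_cycleWeights_sq hr0 hqr hr1).tendsto_sum_nat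

end CycleSeries



section PerSlice

variable {q : ℕ}

/-- `(Π_i (λ_i(1+δ_i))^{c_i}/c_i!) · Π_i ((2(i+1))^{c_i} c_i!) = Π_i ((q^{2(i+1)}+q)(1+δ_i))^{c_i}`. [folklore] -/
theorem prod_slyCycleLam_tilt_mul (q : ℕ) {k : ℕ} (δ : Fin k → ℝ) (c : Fin k → ℕ) :
    (∏ i : Fin k, (slyCycleLam q k i * (1 + δ i)) ^ c i / ((c i).factorial : ℝ)) *
        (∏ i : Fin k, ((2 * ((i : ℕ) + 1)) ^ c i * (c i).factorial : ℝ)) =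
      ∏ i : Fin k, ((((q : ℝ) ^ (2 * ((i : ℕ) + 1)) + q)) * (1 + δ i)) ^ (c i) := by
  rw [← Finset.prod_mul_distrib]
  refine Finset.prod_congr rfl fun i _ => ?_
  unfold slyCycleLam
  have h1 : (0 : ℝ) < 2 * ((i : ℝ) + 1) := by positivity
  have h2 : (0 : ℝ) < (c i).factorial := by exact_mod_cast Nat.factorial_pos _
  simp only [mul_pow, div_pow]
  field_simp

set_option maxHeartbeats 1600000 in
open scoped Classical in
/-- **Sly's Lemma 3.9, pointwise lower tail of one slice, from its three inputs** (the planted lower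
bound (P) of Lemma 3.8 and the second-moment ratio bound of Lemma 3.5 / Theorem 3.10's window, as
hypotheses; the cycle-count moments (U)/(L) of Lemma 3.7 from `sly_cycleBinom_bounds`): for every
`θ > 0` there are `χ > 0` and `n₀` such that for all `n ≥ n₀`, `m' ≤ n^{1/10}`, all boundaries
`η = (E⁺, E⁻)` and all slices `(a, b)` with `|a/n - p⁺|, |b/n - p⁻| ≤ χ`,
`#{ω : Z_{a,b}(η)(ω) ≤ (2/√n) E Z_{a,b}(η)} ≤ θ |Ω|`. [cite: Sly2010, Lemma 3.9 and Theorem 3.6] -/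
theorem sly_perSlice_of_inputs (q : ℕ) (hq : 2 ≤ q) {pp pm : ℝ} (hpm : 0 < pm) (hlt : pm < pp) (hsum : pp + pm < 1)
    (hρ : (q : ℝ) * (pp * pm) < (1 - pp) * (1 - pm))
    (hPl : ∀ (k B : ℕ) (ε : ℝ), 0 < ε → ∃ χ : ℝ, 0 < χ ∧ ∃ n₀ : ℕ, ∀ n : ℕ, n₀ ≤ n → ∀ m' : ℕ, (m' : ℝ) ≤ (n : ℝ) ^ (1 / 10 : ℝ) →
      ∀ (Ep Em : Finset (Fin m')) (a b : ℕ), |(a : ℝ) / n - pp| ≤ χ → |(b : ℝ) / n - pm| ≤ χ →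
      ∀ mv : Fin k → ℕ, (∀ i, mv i ≤ B) →
        (1 - ε) * (∑ ω : (Fin q → Equiv.Perm (Fin (n + m'))) × Equiv.Perm (Fin n), ((slyZab n m' q a b Ep Em ω : ℕ) : ℝ)) *
            ∏ i : Fin k, ((((q : ℝ) ^ (2 * ((i : ℕ) + 1)) + q)) * (1 + (pp * pm / ((1 - pp) * (1 - pm))) ^ ((i : ℕ) + 1))) ^ (mv i) ≤
          ∑ ω : (Fin q → Equiv.Perm (Fin (n + m'))) × Equiv.Perm (Fin n),
            ((slyZab n m' q a b Ep Em ω : ℕ) : ℝ) * ∏ i : Fin k, ((slyDistinctTuples n m' q ((i : ℕ) + 1) (mv i) ω.1 ω.2 : ℕ) : ℝ))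
    (hS2 : ∀ ε : ℝ, 0 < ε → ∃ χ : ℝ, 0 < χ ∧ ∃ n₀ : ℕ, ∀ n : ℕ, n₀ ≤ n → ∀ m' : ℕ, (m' : ℝ) ≤ (n : ℝ) ^ (1 / 10 : ℝ) →
      ∀ (Ep Em : Finset (Fin m')) (a b : ℕ), |(a : ℝ) / n - pp| ≤ χ → |(b : ℝ) / n - pm| ≤ χ →
        (Fintype.card ((Fin q → Equiv.Perm (Fin (n + m'))) × Equiv.Perm (Fin n)) : ℝ) *
            ∑ ω : (Fin q → Equiv.Perm (Fin (n + m'))) × Equiv.Perm (Fin n), ((slyZab n m' q a b Ep Em ω : ℕ) : ℝ) ^ 2 ≤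
          (1 + ε) * slyTau (q + 1) pp pm *
            (∑ ω : (Fin q → Equiv.Perm (Fin (n + m'))) × Equiv.Perm (Fin n), ((slyZab n m' q a b Ep Em ω : ℕ) : ℝ)) ^ 2)
    (hpos : ∃ χ : ℝ, 0 < χ ∧ ∃ n₀ : ℕ, ∀ n : ℕ, n₀ ≤ n → ∀ m' : ℕ, (m' : ℝ) ≤ (n : ℝ) ^ (1 / 10 : ℝ) →
      ∀ (Ep Em : Finset (Fin m')) (a b : ℕ), |(a : ℝ) / n - pp| ≤ χ → |(b : ℝ) / n - pm| ≤ χ →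
        0 < ∑ ω : (Fin q → Equiv.Perm (Fin (n + m'))) × Equiv.Perm (Fin n), ((slyZab n m' q a b Ep Em ω : ℕ) : ℝ))
    {θ : ℝ} (hθ : 0 < θ) :
    ∃ χ : ℝ, 0 < χ ∧ ∃ n₀ : ℕ, ∀ n : ℕ, n₀ ≤ n → ∀ m' : ℕ, (m' : ℝ) ≤ (n : ℝ) ^ (1 / 10 : ℝ) →
      ∀ (Ep Em : Finset (Fin m')) (a b : ℕ), |(a : ℝ) / n - pp| ≤ χ → |(b : ℝ) / n - pm| ≤ χ →
        ((univ.filter fun ω : (Fin q → Equiv.Perm (Fin (n + m'))) × Equiv.Perm (Fin n) =>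
            ((slyZab n m' q a b Ep Em ω : ℕ) : ℝ) ≤ 2 / Real.sqrt n *
              ((∑ ω' : (Fin q → Equiv.Perm (Fin (n + m'))) × Equiv.Perm (Fin n), ((slyZab n m' q a b Ep Em ω' : ℕ) : ℝ)) /
                Fintype.card ((Fin q → Equiv.Perm (Fin (n + m'))) × Equiv.Perm (Fin n)))).card : ℝ) ≤
          θ * Fintype.card ((Fin q → Equiv.Perm (Fin (n + m'))) × Equiv.Perm (Fin n)) := by
  -- constants of the model
  have hpp : 0 < pp := hpm.trans hlt
  have hpp1 : pp < 1 := by linarith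
  have hpm1 : pm < 1 := by linarith
  have hq1 : (1 : ℝ) ≤ q := by exact_mod_cast (show 1 ≤ q by omega)
  set r : ℝ := pp * pm / ((1 - pp) * (1 - pm)) with hr
  have hden1 : 0 < (1 - pp) * (1 - pm) := mul_pos (by linarith) (by linarith)
  have hr0 : 0 < r := div_pos (mul_pos hpp hpm) hden1
  have hqr : (q : ℝ) * r < 1 := by
    rw [hr, ← mul_div_assoc, div_lt_one hden1]; exact hρ
  have hr1 : r < 1 := by
    calc r = 1 * r := by ring
      _ ≤ (q : ℝ) * r := mul_le_mul_of_nonneg_right hq1 hr0.le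
      _ < 1 := hqr
  set V : ℝ := -(1 / 2) * Real.log (1 - ((q : ℝ) * r) ^ 2) + (q : ℝ) * (-(1 / 2) * Real.log (1 - r ^ 2)) with hV
  have hqr0 : 0 ≤ (q : ℝ) * r := by positivity
  have hqr2 : ((q : ℝ) * r) ^ 2 < 1 := pow_lt_one₀ hqr0 hqr two_ne_zero
  have hr2 : r ^ 2 < 1 := pow_lt_one₀ hr0.le hr1 two_ne_zero
  have hV0 : 0 ≤ V := by
    have l1 : Real.log (1 - ((q : ℝ) * r) ^ 2) ≤ 0 := Real.log_nonpos (by linarith only [hqr2]) (by linarith only [sq_nonneg ((q:ℝ) * r)])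
    have l2 : Real.log (1 - r ^ 2) ≤ 0 := Real.log_nonpos (by linarith only [hr2]) (by linarith only [sq_nonneg r])
    have hq0 : (0 : ℝ) ≤ q := by positivity
    have : 0 ≤ (q : ℝ) * (-(1 / 2) * Real.log (1 - r ^ 2)) := mul_nonneg hq0 (by linarith only [l2])
    rw [hV]; linarith only [l1, this]
  set τ : ℝ := slyTau (q + 1) pp pm with hτ
  have hτV : τ = Real.exp V := by rw [hτ, hV, hr]; exact slyTau_eq_exp q hr0.le hqr hr1
  have hτ1 : 1 ≤ τ := by rw [hτV]; exact Real.one_le_exp hV0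
  have hτ0 : 0 < τ := by linarith
  -- the cycle series
  set f : ℕ → ℝ := fun i => ((q : ℝ) ^ (2 * (i + 1)) + q) / (2 * ((i : ℝ) + 1)) * (r ^ (i + 1)) ^ 2 with hf
  have hf0 : ∀ i, 0 ≤ f i := fun i => by rw [hf]; positivity
  have hS_le : ∀ k, ∑ i ∈ range k, f i ≤ V := fun k => sum_cycleWeights_sq_le q k hr0.le hqr hr1
  have hS_tend : Tendsto (fun k : ℕ => Real.exp (∑ i ∈ range k, f i)) atTop (𝓝 τ) := by
    rw [hτV]; exact tendsto_exp_sum_cycleWeights_sq q hr0.le hqr hr1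
  -- Step 0: the target accuracy `θ' = min θ 1`
  set θ' : ℝ := min θ 1 with hθ'
  have hθ'0 : 0 < θ' := lt_min hθ one_pos
  have hθ'1 : θ' ≤ 1 := min_le_right _ _
  have hθ'θ : θ' ≤ θ := min_le_left _ _
  -- Step 1: `M` (Chebyshev for `log W`)
  set M : ℝ := Real.sqrt (8 * (2 * V + 2) / θ') with hM
  have hMsq : M ^ 2 = 8 * (2 * V + 2) / θ' := by rw [hM, Real.sq_sqrt (by positivity)]
  have hM0 : 0 < M := by rw [hM]; exact Real.sqrt_pos.2 (by positivity)
  -- Step 2: `v` (the level of `W`)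
  set v : ℝ := Real.exp (-M - V) / 4 with hv
  have hv0 : 0 < v := by rw [hv]; positivity
  -- Step 3: `k` (explained variance)
  have hk : ∃ k : ℕ, τ - Real.exp (∑ i ∈ range k, f i) ≤ θ' * v ^ 2 / 8 := by
    have hε : 0 < θ' * v ^ 2 / 8 := by positivity
    have := hS_tend.eventually (Metric.ball_mem_nhds τ hε)
    obtain ⟨k, hk⟩ := this.exists
    refine ⟨k, ?_⟩
    have hk' : |Real.exp (∑ i ∈ range k, f i) - τ| < θ' * v ^ 2 / 8 := by rwa [← Real.dist_eq]
    have := (abs_lt.1 hk').1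
    linarith only [this]
  obtain ⟨k, hkτ⟩ := hk
  set τk : ℝ := Real.exp (∑ i ∈ range k, f i) with hτk
  have hτkτ : τk ≤ τ := by rw [hτk, hτV]; exact Real.exp_le_exp.2 (hS_le k)
  have hτk0 : 0 < τk := Real.exp_pos _
  -- the `Fin k`-indexed data
  set lamv : Fin k → ℝ := slyCycleLam q k with hlamv
  set δv : Fin k → ℝ := fun i => r ^ ((i : ℕ) + 1) with hδv
  set ℓ : Fin k → ℝ := fun i => Real.log (1 + δv i) with hℓ
  have hlam0 : ∀ i, 0 ≤ lamv i := fun i => slyCycleLam_nonneg q k i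
  have hδ0 : ∀ i, 0 ≤ δv i := fun i => by simp only [hδv]; positivity
  have hδ1 : ∀ i, δv i ≤ 1 := fun i => by simp only [hδv]; exact pow_le_one₀ hr0.le hr1.le
  have hℓ0 : ∀ i, 0 ≤ ℓ i := fun i => Real.log_nonneg (by linarith [hδ0 i])
  have hℓδ : ∀ i, ℓ i ≤ δv i := fun i => (log_one_add_bounds (hδ0 i)).1
  have hδℓ : ∀ i, δv i - ℓ i ≤ δv i ^ 2 := fun i => by have := (log_one_add_bounds (hδ0 i)).2; linarith
  have hSk : ∑ i, lamv i * δv i ^ 2 = ∑ i ∈ range k, f i := by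
    rw [← sum_fin_cycleWeights_sq q k r]
    refine Finset.sum_congr rfl fun i _ => ?_
    simp only [hlamv, hδv, slyCycleLam]
  have hSkV : ∑ i, lamv i * δv i ^ 2 ≤ V := by rw [hSk]; exact hS_le k
  set L₁ : ℝ := ∑ i, lamv i * δv i with hL₁
  have hL₁0 : 0 ≤ L₁ := Finset.sum_nonneg fun i _ => mul_nonneg (hlam0 i) (hδ0 i)
  have hℓsum : ∑ i, lamv i * ℓ i ≤ L₁ := Finset.sum_le_sum fun i _ => mul_le_mul_of_nonneg_left (hℓδ i) (hlam0 i)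
  have hℓsum0 : 0 ≤ ∑ i, lamv i * ℓ i := Finset.sum_nonneg fun i _ => mul_nonneg (hlam0 i) (hℓ0 i)
  have hℓsq : ∑ i, lamv i * ℓ i ^ 2 ≤ V := by
    refine le_trans (Finset.sum_le_sum fun i _ => ?_) hSkV
    exact mul_le_mul_of_nonneg_left (pow_le_pow_left₀ (hℓ0 i) (hℓδ i) 2) (hlam0 i)
  have hgap : ∑ i, lamv i * δv i - ∑ i, lamv i * ℓ i ≤ V := by
    rw [← Finset.sum_sub_distrib]
    refine le_trans (Finset.sum_le_sum fun i _ => ?_) hSkV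
    rw [← mul_sub]; exact mul_le_mul_of_nonneg_left (hδℓ i) (hlam0 i)
  -- the Poisson-world constants for this `k`
  have hPinf := sscPinf_pos lamv δv
  have hAinf := sscAinf_pos lamv δv
  have hPA2 : sscPinf lamv δv ^ 2 / sscAinf lamv δv = τk := by rw [sscPinf_sq_div, hSk]
  have hPA : sscPinf lamv δv / sscAinf lamv δv = Real.exp (-L₁) := by rw [sscPinf_div]
  -- Step 4: `ε₁ = η`
  set ε₁ : ℝ := min (min (1 / 10) (θ' * v ^ 2 / (48 * τ))) (1 / (3 * L₁ ^ 2 + 1)) with hε₁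
  have hε₁0 : 0 < ε₁ := lt_min (lt_min (by norm_num) (by positivity)) (by positivity)
  have hε₁10 : ε₁ ≤ 1 / 10 := le_trans (min_le_left _ _) (min_le_left _ _)
  have hε₁v : ε₁ ≤ θ' * v ^ 2 / (48 * τ) := le_trans (min_le_left _ _) (min_le_right _ _)
  have hε₁L : ε₁ ≤ 1 / (3 * L₁ ^ 2 + 1) := min_le_right _ _
  have hε₁1 : ε₁ < 1 := by linarith only [hε₁10]
  have h3εL : 3 * ε₁ * L₁ ^ 2 ≤ 1 := by
    have h1 : ε₁ * (3 * L₁ ^ 2 + 1) ≤ 1 := by rw [← le_div_iff₀ (by positivity)]; exact hε₁L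
    have h2 : ε₁ * (3 * L₁ ^ 2 + 1) = 3 * ε₁ * L₁ ^ 2 + ε₁ := by ring
    linarith only [h1, h2, hε₁0.le]
  -- Step 5: `B`
  have hB : ∃ B : ℕ, 1 ≤ B ∧ (1 - ε₁) * sscPinf lamv δv ≤ sscP lamv δv B ∧
      ∑ i : Fin k, lamv i ^ (B + 1) / ((B + 1).factorial : ℝ) ≤ θ' / 16 := by
    have e1 : ∀ᶠ B : ℕ in atTop, 1 ≤ B := eventually_ge_atTop 1
    have e2 := eventually_sscP_ge lamv δv hε₁0
    have e3 : ∀ᶠ B : ℕ in atTop, ∑ i : Fin k, lamv i ^ (B + 1) / ((B + 1).factorial : ℝ) ≤ θ' / 16 :=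
      (tendsto_sum_pow_div_factorial lamv).eventually_le_const (by positivity)
    exact (e1.and (e2.and e3)).exists
  obtain ⟨B, hB1, hPB, hθ2⟩ := hB
  -- Step 6: the providers
  obtain ⟨n₁, hn₁⟩ := sly_cycleBinom_bounds q k B (by omega) hε₁0
  obtain ⟨χ₂, hχ₂, n₂, hn₂⟩ := hPl k B ε₁ hε₁0
  obtain ⟨χ₃, hχ₃, n₃, hn₃⟩ := hS2 ε₁ hε₁0
  obtain ⟨χ₄, hχ₄, n₄, hn₄⟩ := hpos
  -- Step 7: `n` large for the threshold `t = 2/√n ≤ v`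
  have hn₅ : ∃ n₅ : ℕ, ∀ n : ℕ, n₅ ≤ n → 2 / Real.sqrt n ≤ v ∧ 1 ≤ n := by
    have T : Tendsto (fun n : ℕ => 2 / Real.sqrt n) atTop (𝓝 0) := by
      have h := (tendsto_rpow_neg_atTop (show (0:ℝ) < 1 / 2 by norm_num)).comp tendsto_natCast_atTop_atTop
      have h2 := h.const_mul 2
      rw [mul_zero] at h2
      refine h2.congr' ?_
      filter_upwards [eventually_ge_atTop 1] with n hn
      simp only [Function.comp]
      rw [Real.sqrt_eq_rpow, Real.rpow_neg (Nat.cast_nonneg n)]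
      exact (div_eq_mul_inv 2 _).symm
    obtain ⟨n₅, hn₅⟩ := Filter.eventually_atTop.1 ((T.eventually_le_const hv0).and (eventually_ge_atTop 1))
    exact ⟨n₅, fun n hn => hn₅ n hn⟩
  obtain ⟨n₅, hn₅⟩ := hn₅
  -- the final parameters
  refine ⟨min (min χ₂ χ₃) χ₄, lt_min (lt_min hχ₂ hχ₃) hχ₄, max (max (max n₁ n₂) (max n₃ n₄)) n₅, ?_⟩
  intro n hn m' hm' Ep Em a b ha hb
  have hn1' : n₁ ≤ n := le_trans (le_trans (le_max_left _ _) (le_max_left _ _)) (le_trans (le_max_left _ _) hn)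
  have hn2' : n₂ ≤ n := le_trans (le_trans (le_max_right _ _) (le_max_left _ _)) (le_trans (le_max_left _ _) hn)
  have hn3' : n₃ ≤ n := le_trans (le_trans (le_max_left _ _) (le_max_right _ _)) (le_trans (le_max_left _ _) hn)
  have hn4' : n₄ ≤ n := le_trans (le_trans (le_max_right _ _) (le_max_right _ _)) (le_trans (le_max_left _ _) hn)
  have hn5' : n₅ ≤ n := le_trans (le_max_right _ _) hn
  have ha2 : |(a : ℝ) / n - pp| ≤ χ₂ := le_trans ha (le_trans (min_le_left _ _) (min_le_left _ _))
  have hb2 : |(b : ℝ) / n - pm| ≤ χ₂ := le_trans hb (le_trans (min_le_left _ _) (min_le_left _ _))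
  have ha3 : |(a : ℝ) / n - pp| ≤ χ₃ := le_trans ha (le_trans (min_le_left _ _) (min_le_right _ _))
  have hb3 : |(b : ℝ) / n - pm| ≤ χ₃ := le_trans hb (le_trans (min_le_left _ _) (min_le_right _ _))
  have ha4 : |(a : ℝ) / n - pp| ≤ χ₄ := le_trans ha (min_le_right _ _)
  have hb4 : |(b : ℝ) / n - pm| ≤ χ₄ := le_trans hb (min_le_right _ _)
  obtain ⟨htv, hn1⟩ := hn₅ n hn5'
  -- the space and the variables
  set Ωc : ℝ := (Fintype.card ((Fin q → Equiv.Perm (Fin (n + m'))) × Equiv.Perm (Fin n)) : ℝ) with hΩc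
  set Y : (Fin q → Equiv.Perm (Fin (n + m'))) × Equiv.Perm (Fin n) → ℝ := fun ω => ((slyZab n m' q a b Ep Em ω : ℕ) : ℝ) with hY
  set X : Fin k → (Fin q → Equiv.Perm (Fin (n + m'))) × Equiv.Perm (Fin n) → ℕ := slyCycleX n m' q k with hX
  have hYpos : 0 < ∑ ω, Y ω := hn₄ n hn4' m' hm' Ep Em a b ha4 hb4
  set t : ℝ := 2 / Real.sqrt n with ht
  have ht0 : 0 ≤ t := by positivity
  -- (U), (L)
  have hUL := hn₁ n hn1' m' hm'
  -- (P)
  have hPc : ∀ c : Fin k → ℕ, (∀ i, c i ≤ B) →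
      (1 - ε₁) * (∑ ω, Y ω) * ∏ i, (lamv i * (1 + δv i)) ^ c i / ((c i).factorial : ℝ) ≤ ∑ ω, Y ω * sscBinom X c ω := by
    intro c hc
    have h := hn₂ n hn2' m' hm' Ep Em a b ha2 hb2 c hc
    set D : ℝ := ∏ i : Fin k, ((2 * ((i : ℕ) + 1)) ^ c i * (c i).factorial : ℝ) with hD
    have hD0 : 0 < D := by
      rw [hD]; refine Finset.prod_pos fun i _ => ?_
      have : (0 : ℝ) < (c i).factorial := by exact_mod_cast Nat.factorial_pos _
      positivity
    have hR : ∑ ω : (Fin q → Equiv.Perm (Fin (n + m'))) × Equiv.Perm (Fin n),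
        ((slyZab n m' q a b Ep Em ω : ℕ) : ℝ) * ∏ i : Fin k, ((slyDistinctTuples n m' q ((i : ℕ) + 1) (c i) ω.1 ω.2 : ℕ) : ℝ) =
        D * ∑ ω, Y ω * sscBinom X c ω := by
      rw [Finset.mul_sum]
      refine Finset.sum_congr rfl fun ω _ => ?_
      have := prod_slyDistinctTuples_eq_mul_sscBinom (n := n) (m' := m') (q := q) c ω
      rw [← Nat.cast_prod, this, hY, hX, hD]; ring
    have hL : (∏ i, (lamv i * (1 + δv i)) ^ c i / ((c i).factorial : ℝ)) * D =
        ∏ i : Fin k, ((((q : ℝ) ^ (2 * ((i : ℕ) + 1)) + q)) * (1 + r ^ ((i : ℕ) + 1))) ^ (c i) := by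
      rw [hD, hlamv]; exact prod_slyCycleLam_tilt_mul q δv c
    rw [hR] at h
    rw [← hL] at h
    have h' : D * ((1 - ε₁) * (∑ ω, Y ω) * ∏ i, (lamv i * (1 + δv i)) ^ c i / ((c i).factorial : ℝ)) ≤ D * ∑ ω, Y ω * sscBinom X c ω := by
      refine le_trans (le_of_eq (by ring)) h
    exact le_of_mul_le_mul_left h' hD0
  -- (S)
  have hSc : Ωc * ∑ ω, Y ω ^ 2 ≤ (1 + ε₁) * τ * (∑ ω, Y ω) ^ 2 := hn₃ n hn3' m' hm' Ep Em a b ha3 hb3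
  -- (den): `t < u c'`
  set u : ℝ := Real.exp (∑ i, lamv i * Real.log (1 + δv i) - M) with hu
  set c' : ℝ := (1 - ε₁) * sscP lamv δv B / ((1 + ε₁) * sscA lamv δv B) with hc'
  have hAle : sscA lamv δv B ≤ sscAinf lamv δv := sscA_le_exp hlam0 hδ0 B
  have hA0 : 0 < sscA lamv δv B := sscA_pos hlam0 hδ0 B
  have hc'ge : (1 - ε₁) * (1 - ε₁) / (1 + ε₁) * Real.exp (-L₁) ≤ c' := by
    rw [hc', ← hPA]
    have h1 : (1 - ε₁) * ((1 - ε₁) * sscPinf lamv δv) ≤ (1 - ε₁) * sscP lamv δv B := mul_le_mul_of_nonneg_left hPB (by linarith)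
    have h1e : 0 ≤ 1 - ε₁ := by linarith
    have h2 : 0 ≤ (1 - ε₁) * sscP lamv δv B := le_trans (by positivity) h1
    have eq1 : (1 - ε₁) * (1 - ε₁) / (1 + ε₁) * (sscPinf lamv δv / sscAinf lamv δv) =
        ((1 - ε₁) * ((1 - ε₁) * sscPinf lamv δv)) / ((1 + ε₁) * sscAinf lamv δv) := by
      rw [_root_.div_mul_div_comm]; ring
    rw [eq1]
    calc ((1 - ε₁) * ((1 - ε₁) * sscPinf lamv δv)) / ((1 + ε₁) * sscAinf lamv δv)
        ≤ ((1 - ε₁) * sscP lamv δv B) / ((1 + ε₁) * sscAinf lamv δv) := div_le_div_of_nonneg_right h1 (by positivity)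
      _ ≤ ((1 - ε₁) * sscP lamv δv B) / ((1 + ε₁) * sscA lamv δv B) :=
          div_le_div_of_nonneg_left h2 (by positivity) (mul_le_mul_of_nonneg_left hAle (by linarith))
  have huc' : 2 * v ≤ u * c' := by
    have hfrac : (7 : ℝ) / 10 ≤ (1 - ε₁) * (1 - ε₁) / (1 + ε₁) := by
      rw [le_div_iff₀ (by linarith only [hε₁0])]; nlinarith only [sq_nonneg ε₁, hε₁10, hε₁0]
    have hexp : Real.exp (-M - V) ≤ u * Real.exp (-L₁) := by
      rw [hu, ← Real.exp_add]
      refine Real.exp_le_exp.2 ?_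
      have : ∑ i, lamv i * Real.log (1 + δv i) = ∑ i, lamv i * ℓ i := rfl
      rw [this]; linarith only [hgap, hL₁]
    have hu0 : 0 < u := Real.exp_pos _
    calc 2 * v = (1 / 2) * Real.exp (-M - V) := by rw [hv]; ring
      _ ≤ (7 / 10) * (u * Real.exp (-L₁)) := by linarith only [hexp, Real.exp_pos (-M - V)]
      _ ≤ ((1 - ε₁) * (1 - ε₁) / (1 + ε₁)) * (u * Real.exp (-L₁)) := mul_le_mul_of_nonneg_right hfrac (by positivity)
      _ = u * ((1 - ε₁) * (1 - ε₁) / (1 + ε₁) * Real.exp (-L₁)) := by ring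
      _ ≤ u * c' := mul_le_mul_of_nonneg_left hc'ge hu0.le
  have hden : t < u * c' := by linarith only [htv, huc', hv0]
  -- apply the abstract bound
  have hmain := ssc_lowerTail_le' X Y hYpos hδ0 hlam0 hB1 hε₁0.le hε₁1 hM0 (fun c hc => (hUL c hc).1) (fun c hc => (hUL c hc).2) hPc
    (τ := τ) hSc (t := t) hden
  refine le_trans hmain ?_
  -- bound the three pieces by `θ'/4 + θ'/8 + θ'/8`... and `θ' ≤ θ`
  have hΩ0 : 0 ≤ Ωc := Nat.cast_nonneg _
  rw [mul_comm θ Ωc]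
  refine mul_le_mul_of_nonneg_left ?_ hΩ0
  -- piece 3
  have p3 : ((1 + ε₁) * ∑ i, lamv i * Real.log (1 + δv i) ^ 2 + 3 * ε₁ * (∑ i, lamv i * Real.log (1 + δv i)) ^ 2) / M ^ 2 ≤ θ' / 4 := by
    have e1 : (1 + ε₁) * ∑ i, lamv i * Real.log (1 + δv i) ^ 2 ≤ 2 * V := by
      have : ∑ i, lamv i * Real.log (1 + δv i) ^ 2 = ∑ i, lamv i * ℓ i ^ 2 := rfl
      rw [this]
      have hnn : 0 ≤ ∑ i, lamv i * ℓ i ^ 2 := Finset.sum_nonneg fun i _ => by have := hlam0 i; positivity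
      have hprod := mul_le_mul_of_nonneg_right hε₁10 hnn
      linarith only [hprod, hℓsq, hnn, hV0]
    have e2 : 3 * ε₁ * (∑ i, lamv i * Real.log (1 + δv i)) ^ 2 ≤ 1 := by
      have : ∑ i, lamv i * Real.log (1 + δv i) = ∑ i, lamv i * ℓ i := rfl
      rw [this]
      have hsq : (∑ i, lamv i * ℓ i) ^ 2 ≤ L₁ ^ 2 := pow_le_pow_left₀ hℓsum0 hℓsum 2
      have hprod := mul_le_mul_of_nonneg_left hsq (show 0 ≤ 3 * ε₁ by positivity)
      linarith only [hprod, h3εL]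
    rw [div_le_iff₀ (by positivity), hMsq]
    have : θ' / 4 * (8 * (2 * V + 2) / θ') = 2 * (2 * V + 2) := by field_simp; ring
    rw [this]; linarith only [e1, e2, hV0]
  -- piece 2
  have p2 : (1 + ε₁) * ∑ i, lamv i ^ (B + 1) / ((B + 1).factorial : ℝ) ≤ θ' / 8 := by
    have hnn : 0 ≤ ∑ i, lamv i ^ (B + 1) / ((B + 1).factorial : ℝ) := Finset.sum_nonneg fun i _ => by have := hlam0 i; positivity
    have hprod := mul_le_mul_of_nonneg_right hε₁10 hnn
    linarith only [hprod, hθ2, hnn, hθ'0]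
  -- piece 1
  have p1 : ((1 + ε₁) * τ - (1 - ε₁) ^ 2 * sscP lamv δv B ^ 2 / ((1 + ε₁) * sscA lamv δv B)) / (u * c' - t) ^ 2 ≤ θ' / 4 := by
    have hdpos : v ≤ u * c' - t := by linarith
    have hd2 : v ^ 2 ≤ (u * c' - t) ^ 2 := pow_le_pow_left₀ hv0.le hdpos 2
    -- the numerator
    have hPB2 : (1 - ε₁) ^ 2 * τk ≤ sscP lamv δv B ^ 2 / sscA lamv δv B := by
      rw [← hPA2]
      have h1 : ((1 - ε₁) * sscPinf lamv δv) ^ 2 ≤ sscP lamv δv B ^ 2 := pow_le_pow_left₀ (by positivity) hPB 2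
      calc (1 - ε₁) ^ 2 * (sscPinf lamv δv ^ 2 / sscAinf lamv δv) = ((1 - ε₁) * sscPinf lamv δv) ^ 2 / sscAinf lamv δv := by ring
        _ ≤ sscP lamv δv B ^ 2 / sscAinf lamv δv := div_le_div_of_nonneg_right h1 hAinf.le
        _ ≤ sscP lamv δv B ^ 2 / sscA lamv δv B := div_le_div_of_nonneg_left (by positivity) hA0 hAle
    have hnum : (1 + ε₁) * τ - (1 - ε₁) ^ 2 * sscP lamv δv B ^ 2 / ((1 + ε₁) * sscA lamv δv B) ≤ (τ - τk) + 6 * ε₁ * τ := by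
      have e1 : (1 - ε₁) ^ 2 * sscP lamv δv B ^ 2 / ((1 + ε₁) * sscA lamv δv B) =
          (1 - ε₁) ^ 2 / (1 + ε₁) * (sscP lamv δv B ^ 2 / sscA lamv δv B) := by
        field_simp
      rw [e1]
      have e2 : (1 - ε₁) ^ 2 / (1 + ε₁) * ((1 - ε₁) ^ 2 * τk) ≤ (1 - ε₁) ^ 2 / (1 + ε₁) * (sscP lamv δv B ^ 2 / sscA lamv δv B) :=
        mul_le_mul_of_nonneg_left hPB2 (by positivity)
      have c1 : 1 - 3 * ε₁ ≤ (1 - ε₁) ^ 2 / (1 + ε₁) := by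
        rw [le_div_iff₀ (by linarith only [hε₁0])]; nlinarith only [sq_nonneg ε₁, hε₁0.le, hε₁10]
      have c2 : 1 - 2 * ε₁ ≤ (1 - ε₁) ^ 2 := by nlinarith only [sq_nonneg ε₁]
      have c3 : (1 - 3 * ε₁) * ((1 - 2 * ε₁) * τk) ≤ (1 - ε₁) ^ 2 / (1 + ε₁) * ((1 - ε₁) ^ 2 * τk) :=
        mul_le_mul c1 (mul_le_mul_of_nonneg_right c2 hτk0.le) (mul_nonneg (by linarith only [hε₁10]) hτk0.le) (by positivity)
      have c4 : (1 - 5 * ε₁) * τk ≤ (1 - 3 * ε₁) * ((1 - 2 * ε₁) * τk) := by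
        have : (1 - 5 * ε₁) ≤ (1 - 3 * ε₁) * (1 - 2 * ε₁) := by nlinarith only [sq_nonneg ε₁]
        have := mul_le_mul_of_nonneg_right this hτk0.le
        linarith only [this]
      have c5 := mul_le_mul_of_nonneg_left hτkτ (show 0 ≤ 5 * ε₁ by positivity)
      have c6 := mul_nonneg hε₁0.le hτ0.le
      linarith only [e2, c3, c4, c5, c6]
    calc ((1 + ε₁) * τ - (1 - ε₁) ^ 2 * sscP lamv δv B ^ 2 / ((1 + ε₁) * sscA lamv δv B)) / (u * c' - t) ^ 2
        ≤ ((τ - τk) + 6 * ε₁ * τ) / (u * c' - t) ^ 2 := div_le_div_of_nonneg_right hnum (by positivity)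
      _ ≤ ((τ - τk) + 6 * ε₁ * τ) / v ^ 2 := by
          refine div_le_div_of_nonneg_left ?_ (by positivity) hd2
          have c6 := mul_nonneg hε₁0.le hτ0.le
          linarith only [hτkτ, c6]
      _ ≤ θ' / 4 := by
          rw [div_le_iff₀ (by positivity)]
          have e4 : 6 * ε₁ * τ ≤ θ' * v ^ 2 / 8 := by
            have h6 := mul_le_mul_of_nonneg_right hε₁v (show 0 ≤ 6 * τ by positivity)
            have e5 : θ' * v ^ 2 / (48 * τ) * (6 * τ) = θ' * v ^ 2 / 8 := by field_simp; ring
            linarith only [h6, e5]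
          linarith only [hkτ, e4]
  have hsum3 := add_le_add p1 (add_le_add p2 p3)
  rw [add_assoc]
  refine le_trans ?_ (le_trans hsum3 (by linarith only [hθ'θ, hθ'0]))
  exact le_of_eq rfl

end PerSlice

end Literature.Computability.Complexity
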